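import Mathlib
import Literature.Analysis.FluidPDE.TypeIAncientMildRssPullback
import Summits.NavierStokesRegularity.NavierStokesRegularity.Theorems.CoriolisHeadTypeIRateTransport
import HarnessLib

/-!
# Crux E `PowerGaugeEulerLiouville` (stmt-NavierStokesRegularity-19832): ONE-PARAMETER ROTATION GROUPS `exp(t B)` OF `ℝ³` (B skew)
# — measure-theoretic tools for the rotational twin of `GalileanFrames.harmonicShearVanishes` (width seat ns-ezl-w3 g5)

Route №10 `EulerZoomLiouville` (NavierStokesRegularity), crux E.  For a skew operator `B` on `ℝ³` (`⟪Bx, x⟫ = 0`, the generator of the Killing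
field `y ↦ By`) and `R_t = exp(t B)` (`NormedSpace.exp (t • B)`; group law, isometry and commutation with `B` are the tree's
`Literature…rss_exp_add_smul` / `rss_exists_rot` and `CoriolisHead.TypeIRate.hasDerivAt_flow` / `flow_flow_neg` / `norm_exp_smul_skew` /
`exp_smul_apply_comm`):

* `inner_skew_swap` — polarisation: `⟪Bx, y⟫ = −⟪x, By⟫`; `hasDerivAt_expSkew_neg_apply` — `d/dt R_{−t} x = −B R_{−t} x`;
* `inner_expSkew_left` — the adjoint of `R_t` is `R_{−t}`: `⟪R_t x, y⟫ = ⟪x, R_{−t} y⟫`;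
* `measurePreserving_expSkew`, `integral_comp_expSkew`, `setLIntegral_ball_comp_expSkew`, `locallyIntegrable_comp_expSkew` — `R_t` preserves
  Lebesgue measure, whole-space integrals, origin-centred ball integrals and local integrability under composition.

WHAT THIS IS NOT: not NS regularity, not the crux E — linear-algebra tools for symmetry strata of the crux CLASS 19832 (MODEL lattice; E/NS strata),
`--supports` stmt-19832; 19832 OPEN. [folklore]
-/

noncomputable section

-- flat `Theorems/<Route><Decl>…` files of one crux share the namespace of the crux (tree convention: `Summit.<S>.<S>.…`)
set_option linter.dupNamespace false

open MeasureTheory Set Filter Topology Metric Function InnerProductSpace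
open scoped RealInnerProductSpace ENNReal

namespace Summit.NavierStokesRegularity.NavierStokesRegularity.Theorems.PowerGaugeEulerLiouville

namespace Killing

open Literature.Analysis Literature.Analysis.FluidPDE
open Summit.NavierStokesRegularity.NavierStokesRegularity.Theorems.CoriolisHead

variable {B : EuclideanSpace ℝ (Fin 3) →L[ℝ] EuclideanSpace ℝ (Fin 3)}

/-- Polarisation of skewness: `⟪Bx, x⟫ = 0` for all `x` gives `⟪Bx, y⟫ = −⟪x, By⟫`. [folklore] -/
theorem inner_skew_swap (hB : ∀ x : EuclideanSpace ℝ (Fin 3), ⟪B x, x⟫ = 0) (x y : EuclideanSpace ℝ (Fin 3)) :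
    ⟪B x, y⟫ = -⟪x, B y⟫ := by
  have h := hB (x + y)
  rw [map_add, inner_add_left, inner_add_right, inner_add_right, hB x, hB y, zero_add, add_zero] at h
  rw [real_inner_comm x (B y)] at h
  linarith

/-- `R_0 x = x`. [folklore] -/
theorem expSkew_zero_apply (B : EuclideanSpace ℝ (Fin 3) →L[ℝ] EuclideanSpace ℝ (Fin 3)) (x : EuclideanSpace ℝ (Fin 3)) :
    NormedSpace.exp ((0 : ℝ) • B) x = x := by
  rw [show ((0 : ℝ) • B) = 0 from zero_smul ℝ B, NormedSpace.exp_zero]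
  rfl

/-- `R_{−t} (R_t x) = x`. [folklore] -/
theorem expSkew_neg_apply_expSkew (B : EuclideanSpace ℝ (Fin 3) →L[ℝ] EuclideanSpace ℝ (Fin 3)) (t : ℝ) (x : EuclideanSpace ℝ (Fin 3)) :
    NormedSpace.exp ((-t) • B) (NormedSpace.exp (t • B) x) = x := by
  have h := TypeIRate.flow_flow_neg B x (-t)
  rwa [neg_neg] at h

/-- `d/dt R_{−t} x = −B R_{−t} x`. [folklore] -/
theorem hasDerivAt_expSkew_neg_apply (B : EuclideanSpace ℝ (Fin 3) →L[ℝ] EuclideanSpace ℝ (Fin 3)) (x : EuclideanSpace ℝ (Fin 3)) (t : ℝ) :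
    HasDerivAt (fun s : ℝ => NormedSpace.exp ((-s) • B) x) (-(B (NormedSpace.exp ((-t) • B) x))) t := by
  have h := (TypeIRate.hasDerivAt_flow B x (-t)).scomp t (hasDerivAt_neg t)
  simpa only [Function.comp_def, neg_one_smul] using h

/-- **Rotations preserve the inner product**: `⟪R_t x, R_t y⟫ = ⟪x, y⟫`. [folklore] -/
theorem inner_expSkew_expSkew (hB : ∀ x : EuclideanSpace ℝ (Fin 3), ⟪B x, x⟫ = 0) (t : ℝ) (x y : EuclideanSpace ℝ (Fin 3)) :
    ⟪NormedSpace.exp (t • B) x, NormedSpace.exp (t • B) y⟫ = ⟪x, y⟫ := by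
  obtain ⟨L, -, hL⟩ := rss_exists_rot hB t
  rw [← hL x, ← hL y, L.symm.inner_map_map]

/-- The adjoint of `R_t` is `R_{−t}`: `⟪R_t x, y⟫ = ⟪x, R_{−t} y⟫`. [folklore] -/
theorem inner_expSkew_left (hB : ∀ x : EuclideanSpace ℝ (Fin 3), ⟪B x, x⟫ = 0) (t : ℝ) (x y : EuclideanSpace ℝ (Fin 3)) :
    ⟪NormedSpace.exp (t • B) x, y⟫ = ⟪x, NormedSpace.exp ((-t) • B) y⟫ := by
  conv_lhs => rw [← TypeIRate.flow_flow_neg B y t]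
  rw [inner_expSkew_expSkew hB]

/-- **Rotations preserve Lebesgue measure.** [folklore] -/
theorem measurePreserving_expSkew (hB : ∀ x : EuclideanSpace ℝ (Fin 3), ⟪B x, x⟫ = 0) (t : ℝ) :
    MeasurePreserving (fun x : EuclideanSpace ℝ (Fin 3) => NormedSpace.exp (t • B) x) volume volume := by
  obtain ⟨L, -, hL⟩ := rss_exists_rot hB t
  have he : (fun x : EuclideanSpace ℝ (Fin 3) => NormedSpace.exp (t • B) x) = ⇑L.symm := by
    funext x; exact (hL x).symm
  rw [he]
  exact L.symm.measurePreserving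

/-- Integrals are invariant under rotation of the argument: `∫ G(R_t z) dz = ∫ G`. [folklore] -/
theorem integral_comp_expSkew (hB : ∀ x : EuclideanSpace ℝ (Fin 3), ⟪B x, x⟫ = 0) (t : ℝ)
    {F : Type*} [NormedAddCommGroup F] [NormedSpace ℝ F] (G : EuclideanSpace ℝ (Fin 3) → F) :
    ∫ z, G (NormedSpace.exp (t • B) z) = ∫ y, G y := by
  obtain ⟨L, -, hL⟩ := rss_exists_rot hB t
  have he : (fun x : EuclideanSpace ℝ (Fin 3) => NormedSpace.exp (t • B) x) = ⇑L.symm := by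
    funext x; exact (hL x).symm
  have h := L.symm.measurePreserving.integral_comp L.symm.toMeasurableEquiv.measurableEmbedding G
  simp only [← hL] at h ⊢
  exact h

/-- Rotated ball integrals: `∫⁻_{B(0,r)} F(R_t z) dz = ∫⁻_{B(0,r)} F`. [folklore] -/
theorem setLIntegral_ball_comp_expSkew (hB : ∀ x : EuclideanSpace ℝ (Fin 3), ⟪B x, x⟫ = 0) (t : ℝ)
    (F : EuclideanSpace ℝ (Fin 3) → ℝ≥0∞) (r : ℝ) :
    ∫⁻ z in ball (0 : EuclideanSpace ℝ (Fin 3)) r, F (NormedSpace.exp (t • B) z) = ∫⁻ y in ball (0 : EuclideanSpace ℝ (Fin 3)) r, F y := by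
  obtain ⟨L, -, hL⟩ := rss_exists_rot hB t
  have h := L.symm.measurePreserving.setLIntegral_comp_preimage_emb L.symm.toMeasurableEquiv.measurableEmbedding F (ball 0 r)
  have hpre : ⇑L.symm ⁻¹' ball (0 : EuclideanSpace ℝ (Fin 3)) r = ball 0 r := by
    ext z
    simp only [mem_preimage, mem_ball, dist_zero_right, LinearIsometryEquiv.norm_map]
  rw [hpre] at h
  simp only [hL] at h
  exact h

/-- Local integrability is preserved by rotation of the argument. [folklore] -/
theorem locallyIntegrable_comp_expSkew (hB : ∀ x : EuclideanSpace ℝ (Fin 3), ⟪B x, x⟫ = 0) (t : ℝ)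
    {F : Type*} [NormedAddCommGroup F] {U : EuclideanSpace ℝ (Fin 3) → F} (hU : LocallyIntegrable U volume) :
    LocallyIntegrable (fun z => U (NormedSpace.exp (t • B) z)) volume := by
  obtain ⟨L, -, hL⟩ := rss_exists_rot hB t
  have he : (fun z => U (NormedSpace.exp (t • B) z)) = U ∘ L.symm.toHomeomorph := by
    funext z; simp only [Function.comp_apply]; rw [← hL z]; rfl
  rw [he, ← locallyIntegrable_map_homeomorph L.symm.toHomeomorph]
  have hmap : Measure.map (⇑L.symm.toHomeomorph) (volume : Measure (EuclideanSpace ℝ (Fin 3))) = volume :=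
    L.symm.measurePreserving.map_eq
  rw [hmap]; exact hU

end Killing

end Summit.NavierStokesRegularity.NavierStokesRegularity.Theorems.PowerGaugeEulerLiouville
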